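import Summits.KontsevichZagierPeriods.KontsevichZagierPeriods.Theorems.RootDecompZetaThreeFrontierGZLadderFourPolarP09

/-! # `RootDecompZetaThreeFrontierGZLadderFourPolarP10` — part 10/12 of the mechanical ≤400-line split of `l4_src.lean` (sha256 5cc5a9ee4c47da9a…)
Source: decomp-kz lens-1 g13 Layer4_v1.lean @897236f9 minus the RungFour prelude block (imported from …RungFourPreludeP14); --supports stmt-KontsevichZagierPeriods-27141.
Split by census-1 g10 `gen/splitlean.py`: scopes re-opened with their `open`/`variable`/`set_option` context; mathematics and declaration order unchanged. -/

set_option linter.dupNamespace false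
noncomputable section
set_option linter.dupNamespace false
set_option linter.unusedVariables false
set_option linter.unusedSectionVars false
set_option linter.unusedSimpArgs false
open Set MeasureTheory MvPolynomial
open Literature.NumberTheory.Transcendental
open Summit.KontsevichZagierPeriods.KontsevichZagierPeriods.Theorems.RootDecompZetaThreeFrontierWordMoves
open Summit.KontsevichZagierPeriods.KontsevichZagierPeriods.Cruxes.GZNormalFormWThree.GZLadder.RungThree (congInto_mono congInto_of_mem_closure congInto_of_sub_mem)

namespace Summit.KontsevichZagierPeriods.KontsevichZagierPeriods.Cruxes.GZNormalFormWThree.GZLadder.LayerFour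
open Summit.KontsevichZagierPeriods.KontsevichZagierPeriods.Cruxes.GZNormalFormWThree.GZLadder.RungFour
open Summit.KontsevichZagierPeriods.KontsevichZagierPeriods.Cruxes.GZNormalFormWThree.GZLadder.WlogFour
open Summit.KontsevichZagierPeriods.KontsevichZagierPeriods.Cruxes.GZNormalFormWThree.GZLadder.MatchFour
open Summit.KontsevichZagierPeriods.KontsevichZagierPeriods.Cruxes.GZNormalFormWThree.GZLadder.GapForm
open Literature.ModelTheory.ExponentialFields (IsSemialgebraic)

/-- the primitive on the face `t₃ = t₂` -/
theorem ib_diag (κ3 κ4 : ℕ) (a : ℝ) :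
    ∑ m ∈ Finset.range (κ3 + 1), (ibC κ3 κ4 m : ℝ) * a ^ (κ3 - m) * a ^ (κ4 + m + 1) = (ibS κ3 κ4 : ℝ) * a ^ (κ3 + κ4 + 1) := by
  rw [ibS]
  push_cast
  rw [Finset.sum_mul]
  refine Finset.sum_congr rfl fun m hm => ?_
  rw [Finset.mem_range] at hm
  rw [mul_assoc, ← pow_add, show κ3 - m + (κ4 + m + 1) = κ3 + κ4 + 1 by omega]

/-- the primitive on the face `t₃ = 0` -/
theorem ib_zero (κ3 κ4 : ℕ) (a : ℝ) :
    ∑ m ∈ Finset.range (κ3 + 1), (ibC κ3 κ4 m : ℝ) * a ^ (κ3 - m) * (0 : ℝ) ^ (κ4 + m + 1) = 0 :=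
  Finset.sum_eq_zero fun m _ => by rw [zero_pow (Nat.succ_ne_zero _), mul_zero]

/-- a layer class with no far `t₃`-poles: `γ₃ = α₀₃ = α₁₃ = 0` -/
def famT (q : ℚ) (κ0 κ1 κ2 κ3 κ4 β0 β1 β2 γ1 γ2 α02 : ℕ) (t : Fin 4 → ℝ) : ℝ :=
  (q : ℝ) * ((1 - t 0) ^ κ0 * (t 0 - t 1) ^ κ1 * (t 1 - t 2) ^ κ2 * ((t 2 - t 3) ^ κ3 * t 3 ^ κ4)) /
    (t 0 ^ β0 * t 1 ^ β1 * t 2 ^ β2 * (1 - t 1) ^ γ1 * (1 - t 2) ^ γ2 * (t 0 - t 2) ^ α02)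

/-- its primitive in `t₃` vanishing at `t₃ = 0` -/
def FamT (q : ℚ) (κ0 κ1 κ2 κ3 κ4 β0 β1 β2 γ1 γ2 α02 : ℕ) (t : Fin 4 → ℝ) : ℝ :=
  (q : ℝ) * ((1 - t 0) ^ κ0 * (t 0 - t 1) ^ κ1 * (t 1 - t 2) ^ κ2 *
      ∑ m ∈ Finset.range (κ3 + 1), (ibC κ3 κ4 m : ℝ) * t 2 ^ (κ3 - m) * t 3 ^ (κ4 + m + 1)) /
    (t 0 ^ β0 * t 1 ^ β1 * t 2 ^ β2 * (1 - t 1) ^ γ1 * (1 - t 2) ^ γ2 * (t 0 - t 2) ^ α02)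

/-- Auxiliary step `lay_noT3`: lay no T3. [bookkeeping] -/
theorem lay_noT3 (q : ℚ) (κ0 κ1 κ2 κ3 κ4 β0 β1 β2 γ1 γ2 α02 : ℕ) (t : Fin 4 → ℝ) :
    lay q κ0 κ1 κ2 κ3 κ4 β0 β1 β2 γ1 γ2 0 α02 0 0 t = famT q κ0 κ1 κ2 κ3 κ4 β0 β1 β2 γ1 γ2 α02 t := by
  simp only [lay, famT, pow_zero, mul_one]
  ring

/-- Auxiliary step `famT_sa`: fam T sa. [bookkeeping] -/
theorem famT_sa (q : ℚ) (κ0 κ1 κ2 κ3 κ4 β0 β1 β2 γ1 γ2 α02 : ℕ) :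
    IsSemialgebraicFunOn ℚ bandB4 (famT q κ0 κ1 κ2 κ3 κ4 β0 β1 β2 γ1 γ2 α02) := by
  refine (isSemialgebraicFunOn_aeval_div_aeval isSemialgebraic_bandB4
    (MvPolynomial.C q * ((MvPolynomial.C 1 - MvPolynomial.X 0) ^ κ0 * (MvPolynomial.X 0 - MvPolynomial.X 1) ^ κ1 *
      (MvPolynomial.X 1 - MvPolynomial.X 2) ^ κ2 * ((MvPolynomial.X 2 - MvPolynomial.X 3) ^ κ3 * MvPolynomial.X 3 ^ κ4)))
    (MvPolynomial.X 0 ^ β0 * MvPolynomial.X 1 ^ β1 * MvPolynomial.X 2 ^ β2 * (MvPolynomial.C 1 - MvPolynomial.X 1) ^ γ1 *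
      (MvPolynomial.C 1 - MvPolynomial.X 2) ^ γ2 * (MvPolynomial.X 0 - MvPolynomial.X 2) ^ α02) fun z hz => ?_).congr fun z hz => ?_
  · obtain ⟨h0, h1, h2, h1', h2', h02⟩ := bandB4_facts hz
    simp only [map_mul, map_pow, map_sub, MvPolynomial.aeval_X, map_one]
    exact mul_ne_zero (mul_ne_zero (mul_ne_zero (mul_ne_zero (mul_ne_zero (pow_ne_zero _ h0) (pow_ne_zero _ h1))
      (pow_ne_zero _ h2)) (pow_ne_zero _ h1')) (pow_ne_zero _ h2')) (pow_ne_zero _ h02)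
  · simp only [map_mul, map_pow, map_sub, MvPolynomial.aeval_X, MvPolynomial.aeval_C, map_one, famT, eq_ratCast]

/-- Auxiliary step `FamT_sa`: Fam T sa. [bookkeeping] -/
theorem FamT_sa (q : ℚ) (κ0 κ1 κ2 κ3 κ4 β0 β1 β2 γ1 γ2 α02 : ℕ) :
    IsSemialgebraicFunOn ℚ bandB4 (FamT q κ0 κ1 κ2 κ3 κ4 β0 β1 β2 γ1 γ2 α02) := by
  refine (isSemialgebraicFunOn_aeval_div_aeval isSemialgebraic_bandB4
    (MvPolynomial.C q * ((MvPolynomial.C 1 - MvPolynomial.X 0) ^ κ0 * (MvPolynomial.X 0 - MvPolynomial.X 1) ^ κ1 *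
      (MvPolynomial.X 1 - MvPolynomial.X 2) ^ κ2 *
      ∑ m ∈ Finset.range (κ3 + 1), MvPolynomial.C (ibC κ3 κ4 m) * MvPolynomial.X 2 ^ (κ3 - m) * MvPolynomial.X 3 ^ (κ4 + m + 1)))
    (MvPolynomial.X 0 ^ β0 * MvPolynomial.X 1 ^ β1 * MvPolynomial.X 2 ^ β2 * (MvPolynomial.C 1 - MvPolynomial.X 1) ^ γ1 *
      (MvPolynomial.C 1 - MvPolynomial.X 2) ^ γ2 * (MvPolynomial.X 0 - MvPolynomial.X 2) ^ α02) fun z hz => ?_).congr fun z hz => ?_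
  · obtain ⟨h0, h1, h2, h1', h2', h02⟩ := bandB4_facts hz
    simp only [map_mul, map_pow, map_sub, MvPolynomial.aeval_X, map_one]
    exact mul_ne_zero (mul_ne_zero (mul_ne_zero (mul_ne_zero (mul_ne_zero (pow_ne_zero _ h0) (pow_ne_zero _ h1))
      (pow_ne_zero _ h2)) (pow_ne_zero _ h1')) (pow_ne_zero _ h2')) (pow_ne_zero _ h02)
  · simp only [map_mul, map_pow, map_sub, map_sum, MvPolynomial.aeval_X, MvPolynomial.aeval_C, map_one, FamT, eq_ratCast]

/-- Auxiliary step `FamT_cont`: Fam T cont. [bookkeeping] -/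
theorem FamT_cont (q : ℚ) (κ0 κ1 κ2 κ3 κ4 β0 β1 β2 γ1 γ2 α02 : ℕ) : ∀ y ∈ KZ.openOrderedSimplex 3,
    ContinuousOn (fun t => FamT q κ0 κ1 κ2 κ3 κ4 β0 β1 β2 γ1 γ2 α02 (Fin.snoc y t)) (Icc 0 (y (Fin.last 2))) := by
  intro y _
  have hS : Continuous fun s : ℝ => ∑ m ∈ Finset.range (κ3 + 1), (ibC κ3 κ4 m : ℝ) * y 2 ^ (κ3 - m) * s ^ (κ4 + m + 1) :=
    by fun_prop
  show ContinuousOn (fun s : ℝ => (q : ℝ) * ((1 - y 0) ^ κ0 * (y 0 - y 1) ^ κ1 * (y 1 - y 2) ^ κ2 *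
      ∑ m ∈ Finset.range (κ3 + 1), (ibC κ3 κ4 m : ℝ) * y 2 ^ (κ3 - m) * s ^ (κ4 + m + 1)) /
    (y 0 ^ β0 * y 1 ^ β1 * y 2 ^ β2 * (1 - y 1) ^ γ1 * (1 - y 2) ^ γ2 * (y 0 - y 2) ^ α02)) (Icc 0 (y 2))
  exact ((continuous_const.mul (continuous_const.mul hS)).div_const _).continuousOn

/-- Auxiliary step `FamT_der`: Fam T der. [bookkeeping] -/
theorem FamT_der (q : ℚ) (κ0 κ1 κ2 κ3 κ4 β0 β1 β2 γ1 γ2 α02 : ℕ) : ∀ y ∈ KZ.openOrderedSimplex 3, ∀ t ∈ Ioo 0 (y (Fin.last 2)),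
    HasDerivAt (fun s => FamT q κ0 κ1 κ2 κ3 κ4 β0 β1 β2 γ1 γ2 α02 (Fin.snoc y s))
      (famT q κ0 κ1 κ2 κ3 κ4 β0 β1 β2 γ1 γ2 α02 (Fin.snoc y t)) t := by
  intro y _ t _
  have hS : HasDerivAt (fun s : ℝ => ∑ m ∈ Finset.range (κ3 + 1), (ibC κ3 κ4 m : ℝ) * y 2 ^ (κ3 - m) * s ^ (κ4 + m + 1))
      (∑ m ∈ Finset.range (κ3 + 1), (ibC κ3 κ4 m : ℝ) * y 2 ^ (κ3 - m) * (((κ4 + m + 1 : ℕ) : ℝ) * t ^ (κ4 + m))) t := by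
    refine HasDerivAt.fun_sum fun m _ => ?_
    have h := (hasDerivAt_pow (κ4 + m + 1) t).const_mul ((ibC κ3 κ4 m : ℝ) * y 2 ^ (κ3 - m))
    rw [Nat.add_sub_cancel] at h
    exact h
  show HasDerivAt (fun s : ℝ => (q : ℝ) * ((1 - y 0) ^ κ0 * (y 0 - y 1) ^ κ1 * (y 1 - y 2) ^ κ2 *
      ∑ m ∈ Finset.range (κ3 + 1), (ibC κ3 κ4 m : ℝ) * y 2 ^ (κ3 - m) * s ^ (κ4 + m + 1)) /
    (y 0 ^ β0 * y 1 ^ β1 * y 2 ^ β2 * (1 - y 1) ^ γ1 * (1 - y 2) ^ γ2 * (y 0 - y 2) ^ α02))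
    ((q : ℝ) * ((1 - y 0) ^ κ0 * (y 0 - y 1) ^ κ1 * (y 1 - y 2) ^ κ2 * ((y 2 - t) ^ κ3 * t ^ κ4)) /
    (y 0 ^ β0 * y 1 ^ β1 * y 2 ^ β2 * (1 - y 1) ^ γ1 * (1 - y 2) ^ γ2 * (y 0 - y 2) ^ α02)) t
  rw [← ib_deriv κ3 κ4 (y 2) t]
  exact ((hS.const_mul _).const_mul (q : ℝ)).div_const _

/-- **the `t₃`-disposal move**: one NL move takes `[Δ₄, famT]` to a genus-zero GAP CLASS of dimension 3 (`β₂ ≤ κ₃ + κ₄ + 1`). -/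
theorem famT_lower (q : ℚ) (κ0 κ1 κ2 κ3 κ4 β0 β1 β2 γ1 γ2 α02 : ℕ) (hE : β2 ≤ κ3 + κ4 + 1) (r : KZ.IntegralRep 4)
    (hd : r.domain = KZ.openOrderedSimplex 4) (hi : EqOn r.integrand (famT q κ0 κ1 κ2 κ3 κ4 β0 β1 β2 γ1 γ2 α02) r.domain) :
    ∃ r' : KZ.IntegralRep 3, r'.domain = KZ.openOrderedSimplex 3 ∧
      EqOn r'.integrand (fun y => ((q * ibS κ3 κ4 : ℚ) : ℝ) * ((1 - y 0) ^ κ0 * (y 0 - y 1) ^ κ1 * (y 1 - y 2) ^ κ2 *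
          y 2 ^ (κ3 + κ4 + 1 - β2)) / (y 0 ^ β0 * y 1 ^ β1 * (1 - y 1) ^ γ1 * (1 - y 2) ^ γ2 * (y 0 - y 2) ^ α02)) r'.domain ∧
      KZ.of r - KZ.of r' ∈ KZ.relations := by
  obtain ⟨r', hd', hi', hrel⟩ := nlB4 (famT_sa q κ0 κ1 κ2 κ3 κ4 β0 β1 β2 γ1 γ2 α02) (FamT_sa q κ0 κ1 κ2 κ3 κ4 β0 β1 β2 γ1 γ2 α02)
    (FamT_cont q κ0 κ1 κ2 κ3 κ4 β0 β1 β2 γ1 γ2 α02) (FamT_der q κ0 κ1 κ2 κ3 κ4 β0 β1 β2 γ1 γ2 α02) r hd hi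
  refine ⟨r', hd', fun y hy => ?_, hrel⟩
  rw [hd'] at hy
  obtain ⟨h2, h21, h10, h0⟩ := (mem_simplex_three_iff y).1 hy
  rw [hi']
  show FamT q κ0 κ1 κ2 κ3 κ4 β0 β1 β2 γ1 γ2 α02 (Fin.snoc y (y (Fin.last 2))) -
    FamT q κ0 κ1 κ2 κ3 κ4 β0 β1 β2 γ1 γ2 α02 (Fin.snoc y 0) = _
  simp only [FamT, snoc3_zero, snoc3_one, snoc3_two, snoc3_three, show y (Fin.last 2) = y 2 from rfl, ib_diag, ib_zero,
    mul_zero, zero_div, sub_zero]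
  obtain ⟨m, hm⟩ : ∃ m, κ3 + κ4 + 1 = m + β2 := ⟨κ3 + κ4 + 1 - β2, by omega⟩
  rw [show κ3 + κ4 + 1 - β2 = m by omega, hm, pow_add]
  have hy0 : y 0 ≠ 0 := by linarith
  have hy1 : y 1 ≠ 0 := by linarith
  have hy2 : y 2 ≠ 0 := by linarith
  have hy1' : (1 : ℝ) - y 1 ≠ 0 := by linarith
  have hy2' : (1 : ℝ) - y 2 ≠ 0 := by linarith
  have hy02 : y 0 - y 2 ≠ 0 := by linarith
  push_cast
  field_simp

/-- **the `t₃`-DISPOSAL ENGINE**: a class with no far `t₃`-poles is congruent to ONE genus-zero datum of dimension `3`, hence into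
`gzLT 4` (the bound `β₂ ≤ κ₃ + κ₄ + 1` is condition (3) of `Admissible4`). -/
theorem congInto_gzLT_of_famT (q : ℚ) (κ0 κ1 κ2 κ3 κ4 β0 β1 β2 γ1 γ2 α02 : ℕ) (hE : β2 ≤ κ3 + κ4 + 1)
    (s : KZ.IntegralRep 4) (hd : s.domain = simplex 4)
    (hi : EqOn s.integrand (famT q κ0 κ1 κ2 κ3 κ4 β0 β1 β2 γ1 γ2 α02) s.domain) : CongInto (gzLT 4) (KZ.of s) := by
  obtain ⟨r', hd', hi', hrel⟩ := famT_lower q κ0 κ1 κ2 κ3 κ4 β0 β1 β2 γ1 γ2 α02 hE s hd hi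
  have h02 : ((0 : Fin 3) < 2) = True := eq_true (by decide)
  refine congInto_of_sub_mem hrel (congInto_self ⟨3, r', by norm_num, ⟨hd',
    MvPolynomial.C (q * ibS κ3 κ4) * ((MvPolynomial.C 1 - MvPolynomial.X 0) ^ κ0 * (MvPolynomial.X 0 - MvPolynomial.X 1) ^ κ1 *
      (MvPolynomial.X 1 - MvPolynomial.X 2) ^ κ2 * MvPolynomial.X 2 ^ (κ3 + κ4 + 1 - β2)),
    ![![0, 0, α02], ![0, 0, 0], ![0, 0, 0]], ![β0, β1, 0], ![0, γ1, γ2], fun y hy => ?_⟩, rfl⟩)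
  rw [hi' hy]
  simp only [Fin.prod_univ_three, map_mul, map_pow, map_sub, MvPolynomial.aeval_X, MvPolynomial.aeval_C, map_one, eq_ratCast,
    Matrix.cons_val_zero, Matrix.cons_val_one, Matrix.head_cons, Matrix.cons_val_two, Matrix.tail_cons, h02, if_true, pow_zero,
    ite_self, mul_one, one_mul]
  push_cast
  ring

/-- the same over the `IsLayerFour` shape -/
theorem congInto_gzLT_of_lay_noT3 (q : ℚ) (κ0 κ1 κ2 κ3 κ4 β0 β1 β2 γ1 γ2 α02 : ℕ) (hE : β2 ≤ κ3 + κ4 + 1)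
    (s : KZ.IntegralRep 4) (hd : s.domain = simplex 4)
    (hi : EqOn s.integrand (lay q κ0 κ1 κ2 κ3 κ4 β0 β1 β2 γ1 γ2 0 α02 0 0) s.domain) : CongInto (gzLT 4) (KZ.of s) :=
  congInto_gzLT_of_famT q κ0 κ1 κ2 κ3 κ4 β0 β1 β2 γ1 γ2 α02 hE s hd fun t ht => by rw [hi ht, lay_noT3]

/-! ### §L3 The duality move `σ₄` on `Δ₄` for ANY integrand (port of `dual_move3`), and the `t₀`-DISPOSAL ENGINE as its conjugate -/

/-- Auxiliary step `isSemialgebraicMapOn_du4` (§L3): is Semialgebraic Map On du4. [bookkeeping] -/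
theorem isSemialgebraicMapOn_du4 : IsSemialgebraicMapOn ℚ (KZ.openOrderedSimplex 4) du4 :=
  (isSemialgebraicMapOn_aeval (KZ.isSemialgebraic_openOrderedSimplex 4) ![MvPolynomial.C 1 - MvPolynomial.X 3,
    MvPolynomial.C 1 - MvPolynomial.X 2, MvPolynomial.C 1 - MvPolynomial.X 1, MvPolynomial.C 1 - MvPolynomial.X 0]).congr
    fun z _ => by
      funext j
      fin_cases j <;> simp [du4_zero, du4_one, du4_two, du4_three]

/-- Auxiliary step `image_du4` (§L3): image du4. [bookkeeping] -/
theorem image_du4 : du4 '' KZ.openOrderedSimplex 4 = KZ.openOrderedSimplex 4 := by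
  ext z
  constructor
  · rintro ⟨w, hw, rfl⟩; exact mem_simplex_four_du4 hw
  · intro hz; exact ⟨du4 z, mem_simplex_four_du4 hz, du4_du4 z⟩

/-- **the duality move on `Δ₄` for ANY integrand** (rule 2 with the involution `σ₄`): if `r.integrand = r'.integrand ∘ σ₄` on `Δ₄`
then `[r] ≡ [r']`. [Kontsevich–Zagier 2001 §1.2 rule (2)] -/
theorem dual_move4 (r r' : KZ.IntegralRep 4) (hd : r.domain = KZ.openOrderedSimplex 4) (hd' : r'.domain = KZ.openOrderedSimplex 4)
    (h : ∀ z ∈ KZ.openOrderedSimplex 4, r.integrand z = r'.integrand (du4 z)) : KZ.of r - KZ.of r' ∈ KZ.relations := by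
  have hΦsa : IsSemialgebraicMapOn ℚ r.domain du4 := by rw [hd]; exact isSemialgebraicMapOn_du4
  have hder : ∀ x ∈ r.domain, HasFDerivWithinAt du4 du4L r.domain x := fun x _ => (hasFDerivAt_du4 x).hasFDerivWithinAt
  have hinj : InjOn du4 r.domain := fun a _ b _ hab => by
    have := congrArg du4 hab
    rwa [du4_du4, du4_du4] at this
  have hdom : r'.domain = du4 '' r.domain := by rw [hd, hd', image_du4]
  refine KZ.changeOfVariablesRel_subset_relations ⟨4, r, r', du4, fun _ => du4L, hΦsa, hder, hinj, hdom, fun z hz => ?_, rfl⟩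
  have hz' : z ∈ KZ.openOrderedSimplex 4 := by rw [← hd]; exact hz
  show r.integrand z = r'.integrand (du4 z) * |du4L.det|
  rw [abs_det_du4L, mul_one, h z hz']

/-- the dual representation `σ₄^* r = [Δ₄, r.integrand ∘ σ₄]` -/
def dualRep4 (r : KZ.IntegralRep 4) (hd : r.domain = KZ.openOrderedSimplex 4) : KZ.IntegralRep 4 :=
  ⟨KZ.openOrderedSimplex 4, fun t => r.integrand (du4 t), KZ.isSemialgebraic_openOrderedSimplex 4,
    IsSemialgebraicFunOn.comp_isSemialgebraicMapOn_holds (hd ▸ r.isSemialgebraicFunOn_integrand) isSemialgebraicMapOn_du4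
      fun _ ht => mem_simplex_four_du4 ht,
    integrableOn_comp_du4 (hd ▸ r.integrableOn)⟩

/-- Auxiliary step `dualRep4_integrand` (§L3): dual Rep4 integrand. [bookkeeping] -/
theorem dualRep4_integrand (r : KZ.IntegralRep 4) (hd : r.domain = KZ.openOrderedSimplex 4) (t : Fin 4 → ℝ) :
    (dualRep4 r hd).integrand t = r.integrand (du4 t) := rfl

/-- `[r] ≡ [σ₄^* r]` -/
theorem dual_move4' (r : KZ.IntegralRep 4) (hd : r.domain = KZ.openOrderedSimplex 4) :
    KZ.of r - KZ.of (dualRep4 r hd) ∈ KZ.relations :=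
  dual_move4 r (dualRep4 r hd) hd rfl fun z _ => by rw [dualRep4_integrand, du4_du4]

/-- `CongInto` is transported along the duality move -/
theorem congInto_of_dual4 (S : Set KZ.FormalRep) (r : KZ.IntegralRep 4) (hd : r.domain = KZ.openOrderedSimplex 4)
    (h : CongInto S (KZ.of (dualRep4 r hd))) : CongInto S (KZ.of r) := by
  obtain ⟨m, hm, hrel⟩ := h
  refine ⟨m, hm, ?_⟩
  have e : KZ.of r - m = (KZ.of r - KZ.of (dualRep4 r hd)) + (KZ.of (dualRep4 r hd) - m) := by abel
  rw [e]
  exact add_mem (dual_move4' r hd) hrel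

/-- the `σ₄`-conjugate of a layer class is a layer class with REFLECTED exponents:
`κ ↦ (κ₄,κ₃,κ₂,κ₁,κ₀)`, `(β₀,β₁,β₂) ↦ (γ₃,γ₂,γ₁)`, `(γ₁,γ₂,γ₃) ↦ (β₂,β₁,β₀)`, `(α₀₂,α₀₃,α₁₃) ↦ (α₁₃,α₀₃,α₀₂)` -/
theorem lay_du4 (q : ℚ) (κ0 κ1 κ2 κ3 κ4 β0 β1 β2 γ1 γ2 γ3 α02 α03 α13 : ℕ) (t : Fin 4 → ℝ) :
    lay q κ0 κ1 κ2 κ3 κ4 β0 β1 β2 γ1 γ2 γ3 α02 α03 α13 (du4 t) = lay q κ4 κ3 κ2 κ1 κ0 γ3 γ2 γ1 β2 β1 β0 α13 α03 α02 t := by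
  simp only [lay, du4_zero, du4_one, du4_two, du4_three, sub_sub_cancel, sub_sub_sub_cancel_left]
  ring

/-- **the `t₀`-DISPOSAL ENGINE** (§L2 conjugated by `σ₄`): a class with no far `t₀`-poles (`β₀ = α₀₂ = α₀₃ = 0`) is congruent into
`gzLT 4` (the bound `γ₁ ≤ κ₀ + κ₁ + 1` is condition (6) of `Admissible4`). -/
theorem congInto_gzLT_of_lay_noT0 (q : ℚ) (κ0 κ1 κ2 κ3 κ4 β1 β2 γ1 γ2 γ3 α13 : ℕ) (hE : γ1 ≤ κ0 + κ1 + 1)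
    (s : KZ.IntegralRep 4) (hd : s.domain = simplex 4)
    (hi : EqOn s.integrand (lay q κ0 κ1 κ2 κ3 κ4 0 β1 β2 γ1 γ2 γ3 0 0 α13) s.domain) : CongInto (gzLT 4) (KZ.of s) := by
  refine congInto_of_dual4 _ s hd (congInto_gzLT_of_lay_noT3 q κ4 κ3 κ2 κ1 κ0 γ3 γ2 γ1 β2 β1 α13 (by omega) (dualRep4 s hd) rfl
    fun t ht => ?_)
  rw [dualRep4_integrand, hi (by rw [hd]; exact mem_simplex_four_du4 ht), lay_du4]

/-- **LAYER₄, THE TWO DISPOSAL CASES** (into `cellGens 4 ∪ gzLT 4`, the target of the layer step). -/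
theorem layer_four_disposal (q : ℚ) (κ0 κ1 κ2 κ3 κ4 β0 β1 β2 γ1 γ2 γ3 α02 α03 α13 : ℕ) (s : KZ.IntegralRep 4)
    (hd : s.domain = simplex 4) (hi : EqOn s.integrand (lay q κ0 κ1 κ2 κ3 κ4 β0 β1 β2 γ1 γ2 γ3 α02 α03 α13) s.domain)
    (h : (γ3 = 0 ∧ α03 = 0 ∧ α13 = 0 ∧ β2 ≤ κ3 + κ4 + 1) ∨ (β0 = 0 ∧ α02 = 0 ∧ α03 = 0 ∧ γ1 ≤ κ0 + κ1 + 1)) :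
    CongInto (cellGens 4 ∪ gzLT 4) (KZ.of s) := by
  refine congInto_mono subset_union_right ?_
  rcases h with ⟨rfl, rfl, rfl, hE⟩ | ⟨rfl, rfl, rfl, hE⟩
  · exact congInto_gzLT_of_lay_noT3 q κ0 κ1 κ2 κ3 κ4 β0 β1 β2 γ1 γ2 α02 hE s hd hi
  · exact congInto_gzLT_of_lay_noT0 q κ0 κ1 κ2 κ3 κ4 β1 β2 γ1 γ2 γ3 α13 hE s hd hi

/-! ### §L4 The generic `t₃`-INTEGRATION-BY-PARTS ENGINE (port of `WordLayer.ibpT2`) and the `t₀`-IBP engine as its `σ₄`-conjugate: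
for EVERY `P ∈ ℚ[t₀,t₁,t₂,t₃]`, `[Δ₄, ibpQ4(P)/den(…,γ₃+1,…,α₀₃+1,α₁₃+1)] ≡ [Δ₃, ONE genus-zero datum]`, where
`ibpQ4(P) = ∂₃P·(1-t₃)(t₀-t₃)(t₁-t₃) + P·(γ₃ (t₀-t₃)(t₁-t₃) + α₀₃ (1-t₃)(t₁-t₃) + α₁₃ (1-t₃)(t₀-t₃))` is `∂₃` of
`P/den(…,γ₃,…,α₀₃,α₁₃)` cleared of denominators, and the boundary terms `F(t₀,t₁,t₂,t₂) - F(t₀,t₁,t₂,0)` combine over the common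
denominator `y₀^{β₀+α₀₃} y₁^{β₁+α₁₃} y₂^{β₂} (1-y₁)^{γ₁} (1-y₂)^{γ₂+γ₃} (y₀-y₂)^{α₀₂+α₀₃} (y₁-y₂)^{α₁₃}`.  Hence every `t₃`-EXACT
class, and dually every `t₀`-EXACT class, is `CongInto (gzLT 4)`. -/

/-- the 9-factor class `P/den` of a reduced datum (the shape of `IsReducedFour`) -/
def layF (P : MvPolynomial (Fin 4) ℚ) (β0 β1 β2 γ1 γ2 γ3 α02 α03 α13 : ℕ) (t : Fin 4 → ℝ) : ℝ :=
  MvPolynomial.aeval t P / (t 0 ^ β0 * t 1 ^ β1 * t 2 ^ β2 * (1 - t 1) ^ γ1 * (1 - t 2) ^ γ2 * (1 - t 3) ^ γ3 * (t 0 - t 2) ^ α02 *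
    (t 0 - t 3) ^ α03 * (t 1 - t 3) ^ α13)

/-- Auxiliary step `vec4_0` (§L4): vec4 0. [bookkeeping] -/
private theorem vec4_0 (a b c d : ℝ) : (![a, b, c, d] : Fin 4 → ℝ) 0 = a := rfl
/-- Auxiliary step `vec4_1` (§L4): vec4 1. [bookkeeping] -/
private theorem vec4_1 (a b c d : ℝ) : (![a, b, c, d] : Fin 4 → ℝ) 1 = b := rfl
/-- Auxiliary step `vec4_2` (§L4): vec4 2. [bookkeeping] -/
private theorem vec4_2 (a b c d : ℝ) : (![a, b, c, d] : Fin 4 → ℝ) 2 = c := rfl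
/-- Auxiliary step `vec4_3` (§L4): vec4 3. [bookkeeping] -/
private theorem vec4_3 (a b c d : ℝ) : (![a, b, c, d] : Fin 4 → ℝ) 3 = d := rfl

/-- the coordinate functions of `s ↦ (y₀, y₁, y₂, s)` and their derivatives, read through `∂₃ Xᵢ` -/
theorem hasDerivAt_snoc_apply4 (y : Fin 3 → ℝ) (i : Fin 4) (t : ℝ) :
    HasDerivAt (fun s => (Fin.snoc y s : Fin 4 → ℝ) i)
      (MvPolynomial.aeval (Fin.snoc y t : Fin 4 → ℝ) (MvPolynomial.pderiv 3 (MvPolynomial.X i : MvPolynomial (Fin 4) ℚ))) t := by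
  by_cases hi : i = 3
  · subst hi
    rw [MvPolynomial.pderiv_X_self, map_one]
    exact hasDerivAt_id t
  · rw [MvPolynomial.pderiv_X_of_ne hi, map_zero]
    obtain ⟨j, rfl⟩ := Fin.exists_castSucc_eq.2 hi
    simp only [Fin.snoc_castSucc]
    exact hasDerivAt_const t (y j)

/-- differentiation of `s ↦ P(y₀, y₁, y₂, s)` is evaluation of `∂₃P` -/
theorem hasDerivAt_aeval_snoc4 (y : Fin 3 → ℝ) (t : ℝ) (P : MvPolynomial (Fin 4) ℚ) :
    HasDerivAt (fun s => MvPolynomial.aeval (Fin.snoc y s : Fin 4 → ℝ) P)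
      (MvPolynomial.aeval (Fin.snoc y t : Fin 4 → ℝ) (MvPolynomial.pderiv 3 P)) t := by
  induction P using MvPolynomial.induction_on with
  | C a =>
    simp only [MvPolynomial.aeval_C, MvPolynomial.pderiv_C, map_zero]
    exact hasDerivAt_const t _
  | add p q hp hq =>
    simp only [map_add]
    exact hp.add hq
  | mul_X p i hp =>
    have hf : (fun s => MvPolynomial.aeval (Fin.snoc y s : Fin 4 → ℝ) (p * MvPolynomial.X i)) =
        fun s => MvPolynomial.aeval (Fin.snoc y s : Fin 4 → ℝ) p * (Fin.snoc y s : Fin 4 → ℝ) i :=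
      funext fun s => by rw [map_mul, MvPolynomial.aeval_X]
    rw [hf, MvPolynomial.pderiv_mul, map_add, map_mul, map_mul, MvPolynomial.aeval_X]
    exact hp.mul (hasDerivAt_snoc_apply4 y i t)

/-- continuity of `s ↦ P(y₀, y₁, y₂, s)` -/
theorem continuous_aeval_snoc4 (y : Fin 3 → ℝ) (P : MvPolynomial (Fin 4) ℚ) :
    Continuous (fun s => MvPolynomial.aeval (Fin.snoc y s : Fin 4 → ℝ) P) :=
  continuous_iff_continuousAt.2 fun s => (hasDerivAt_aeval_snoc4 y s P).continuousAt

/-- the IBP numerator `∂₃P·(1-t₃)(t₀-t₃)(t₁-t₃) + P·(γ₃ (t₀-t₃)(t₁-t₃) + α₀₃ (1-t₃)(t₁-t₃) + α₁₃ (1-t₃)(t₀-t₃))` -/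
def ibpQ4 (P : MvPolynomial (Fin 4) ℚ) (γ3 α03 α13 : ℕ) : MvPolynomial (Fin 4) ℚ :=
  MvPolynomial.pderiv 3 P * ((MvPolynomial.C 1 - MvPolynomial.X 3) * (MvPolynomial.X 0 - MvPolynomial.X 3) *
    (MvPolynomial.X 1 - MvPolynomial.X 3)) +
    P * (MvPolynomial.C (γ3 : ℚ) * ((MvPolynomial.X 0 - MvPolynomial.X 3) * (MvPolynomial.X 1 - MvPolynomial.X 3)) +
      MvPolynomial.C (α03 : ℚ) * ((MvPolynomial.C 1 - MvPolynomial.X 3) * (MvPolynomial.X 1 - MvPolynomial.X 3)) +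
      MvPolynomial.C (α13 : ℚ) * ((MvPolynomial.C 1 - MvPolynomial.X 3) * (MvPolynomial.X 0 - MvPolynomial.X 3)))

/-- the combined boundary numerator `P(y,y₂)·y₀^{α₀₃} y₁^{α₁₃} - P(y,0)·(1-y₂)^{γ₃} (y₀-y₂)^{α₀₃} (y₁-y₂)^{α₁₃} ∈ ℚ[y₀,y₁,y₂]` -/
def ibpB4 (P : MvPolynomial (Fin 4) ℚ) (γ3 α03 α13 : ℕ) : MvPolynomial (Fin 3) ℚ :=
  MvPolynomial.bind₁ ![MvPolynomial.X 0, MvPolynomial.X 1, MvPolynomial.X 2, MvPolynomial.X 2] P *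
      (MvPolynomial.X 0 ^ α03 * MvPolynomial.X 1 ^ α13) -
    MvPolynomial.bind₁ ![MvPolynomial.X 0, MvPolynomial.X 1, MvPolynomial.X 2, 0] P *
      ((MvPolynomial.C 1 - MvPolynomial.X 2) ^ γ3 * (MvPolynomial.X 0 - MvPolynomial.X 2) ^ α03 *
        (MvPolynomial.X 1 - MvPolynomial.X 2) ^ α13)

/-- Auxiliary step `layF_sa_band` (§L4): lay F sa band. [bookkeeping] -/
theorem layF_sa_band (P : MvPolynomial (Fin 4) ℚ) (β0 β1 β2 γ1 γ2 γ3 α02 α03 α13 : ℕ) :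
    IsSemialgebraicFunOn ℚ bandB4 (layF P β0 β1 β2 γ1 γ2 γ3 α02 α03 α13) := by
  refine (isSemialgebraicFunOn_aeval_div_aeval isSemialgebraic_bandB4 P
    (MvPolynomial.X 0 ^ β0 * MvPolynomial.X 1 ^ β1 * MvPolynomial.X 2 ^ β2 * (MvPolynomial.C 1 - MvPolynomial.X 1) ^ γ1 *
      (MvPolynomial.C 1 - MvPolynomial.X 2) ^ γ2 * (MvPolynomial.C 1 - MvPolynomial.X 3) ^ γ3 *
      (MvPolynomial.X 0 - MvPolynomial.X 2) ^ α02 * (MvPolynomial.X 0 - MvPolynomial.X 3) ^ α03 *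
      (MvPolynomial.X 1 - MvPolynomial.X 3) ^ α13) fun z hz => ?_).congr fun z hz => ?_
  · obtain ⟨⟨h2, h21, h10, h0⟩, h3, h32⟩ := (mem_bandB4_iff z).1 hz
    simp only [map_mul, map_pow, map_sub, MvPolynomial.aeval_X, map_one]
    have a0 : z 0 ≠ 0 := by linarith
    have a1 : z 1 ≠ 0 := by linarith
    have a2 : z 2 ≠ 0 := by linarith
    have a3 : (1 : ℝ) - z 1 ≠ 0 := by linarith
    have a4 : (1 : ℝ) - z 2 ≠ 0 := by linarith
    have a5 : (1 : ℝ) - z 3 ≠ 0 := by linarith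
    have a6 : z 0 - z 2 ≠ 0 := by linarith
    have a7 : z 0 - z 3 ≠ 0 := by linarith
    have a8 : z 1 - z 3 ≠ 0 := by linarith
    exact mul_ne_zero (mul_ne_zero (mul_ne_zero (mul_ne_zero (mul_ne_zero (mul_ne_zero (mul_ne_zero (mul_ne_zero
      (pow_ne_zero _ a0) (pow_ne_zero _ a1)) (pow_ne_zero _ a2)) (pow_ne_zero _ a3)) (pow_ne_zero _ a4)) (pow_ne_zero _ a5))
      (pow_ne_zero _ a6)) (pow_ne_zero _ a7)) (pow_ne_zero _ a8)
  · simp only [map_mul, map_pow, map_sub, MvPolynomial.aeval_X, map_one, layF]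

/-- Auxiliary step `layF_cont` (§L4): lay F cont. [bookkeeping] -/
theorem layF_cont (P : MvPolynomial (Fin 4) ℚ) (β0 β1 β2 γ1 γ2 γ3 α02 α03 α13 : ℕ) : ∀ y ∈ KZ.openOrderedSimplex 3,
    ContinuousOn (fun s => layF P β0 β1 β2 γ1 γ2 γ3 α02 α03 α13 (Fin.snoc y s)) (Icc 0 (y (Fin.last 2))) := by
  intro y hy
  obtain ⟨h2, h21, h10, h0⟩ := (mem_simplex_three_iff y).1 hy
  show ContinuousOn (fun s => MvPolynomial.aeval (Fin.snoc y s : Fin 4 → ℝ) P /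
    (y 0 ^ β0 * y 1 ^ β1 * y 2 ^ β2 * (1 - y 1) ^ γ1 * (1 - y 2) ^ γ2 * (1 - s) ^ γ3 * (y 0 - y 2) ^ α02 * (y 0 - s) ^ α03 *
      (y 1 - s) ^ α13)) (Icc 0 (y 2))
  refine ContinuousOn.div (continuous_aeval_snoc4 y P).continuousOn (by fun_prop) fun s hs => ?_
  have hs1 : s ≤ y 2 := hs.2
  have a0 : y 0 ≠ 0 := by linarith
  have a1 : y 1 ≠ 0 := by linarith
  have a2 : y 2 ≠ 0 := by linarith
  have a3 : (1 : ℝ) - y 1 ≠ 0 := by linarith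
  have a4 : (1 : ℝ) - y 2 ≠ 0 := by linarith
  have a5 : (1 : ℝ) - s ≠ 0 := by linarith
  have a6 : y 0 - y 2 ≠ 0 := by linarith
  have a7 : y 0 - s ≠ 0 := by linarith
  have a8 : y 1 - s ≠ 0 := by linarith
  exact mul_ne_zero (mul_ne_zero (mul_ne_zero (mul_ne_zero (mul_ne_zero (mul_ne_zero (mul_ne_zero (mul_ne_zero
    (pow_ne_zero _ a0) (pow_ne_zero _ a1)) (pow_ne_zero _ a2)) (pow_ne_zero _ a3)) (pow_ne_zero _ a4)) (pow_ne_zero _ a5))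
    (pow_ne_zero _ a6)) (pow_ne_zero _ a7)) (pow_ne_zero _ a8)

end Summit.KontsevichZagierPeriods.KontsevichZagierPeriods.Cruxes.GZNormalFormWThree.GZLadder.LayerFour
end
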